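import Literature.Topology.FourManifolds.TwistCoords
import HarnessLib

/-!
# Cartesian form of the twisted meridian chart along the push-off, through the far point

Topic `Literature/Topology/FourManifolds`; fact seat `provefact-IsStrictHandleSlide.isSurgery`
(R. C. Kirby, *The Topology of 4-Manifolds*, LNM 1374 (1989), Ch. I §4, Fig. 4.2; remaining content:
the named fact (S) `Literature.Topology.FourManifolds.FramedLink.IsStrictHandleSlide.slideModel`).
The twisted chart `Λ_c` of the planar sweep (`SlideSweep.exists_planarSweep`) is given in Cartesian
form: the point `r (a, b)` (`a² + b² = 1`) goes to `(r X, r Y)` with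
`X = ((1+a) - E² (1-a)) / D`, `Y = 2 E b / D`, `D = (1+a) + E² (1-a)`, `E = e^{c r}`. For
`(a, b) = (cos θ, sin θ)` with `θ ∈ (-π, π)` this is `(r cos α, r sin α)`, `α = twistAngle c r θ`
(`TwistCoords.cos_twistAngle`, `sin_twistAngle`), but the Cartesian form is smooth through the far
point `θ = π` of the push-off, where the angle chart is not. This file records the Cartesian
height `sliceY c r a b = r · 2 E b / D`, its agreement with `r sin (twistAngle c r θ)` for every
angle representative off `π + 2πℤ`, the positivity of `D`, and the derivative of the height along
the unit circle at the far point: `d/dθ sliceY c r (cos θ) (sin θ) |_{θ = π} = -r e^{-c r} < 0` —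
the route keeps descending through the far point of the push-off.

## References

* R. C. Kirby, *The Topology of 4-Manifolds*, LNM 1374, Springer (1989), Ch. I §4. [Kirby1989]
-/

open scoped ContDiff Topology
open Set Real Filter

noncomputable section

namespace Literature.Topology.FourManifolds

/-- The denominator `D = (1 + a) + e^{2cr} (1 - a)` of the Cartesian twist. [folklore] -/
def sliceD (c r a : ℝ) : ℝ := (1 + a) + exp (c * r) ^ 2 * (1 - a)

/-- **The Cartesian twisted height** `r · 2 e^{cr} b / D`. [folklore] -/
def sliceY (c r a b : ℝ) : ℝ := r * (2 * exp (c * r) * b / sliceD c r a)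

/-- **The Cartesian twisted abscissa** `r · ((1+a) - e^{2cr}(1-a)) / D`. [folklore] -/
def sliceX (c r a _b : ℝ) : ℝ := r * (((1 + a) - exp (c * r) ^ 2 * (1 - a)) / sliceD c r a)

/-- `sliceD_def` (auxiliary). [folklore] -/
theorem sliceD_def (c r a : ℝ) : sliceD c r a = (1 + a) + exp (c * r) ^ 2 * (1 - a) := rfl
/-- `sliceY_def` (auxiliary). [folklore] -/
theorem sliceY_def (c r a b : ℝ) : sliceY c r a b = r * (2 * exp (c * r) * b / sliceD c r a) := rfl
/-- `sliceX_def` (auxiliary). [folklore] -/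
theorem sliceX_def (c r a b : ℝ) : sliceX c r a b = r * (((1 + a) - exp (c * r) ^ 2 * (1 - a)) / sliceD c r a) := rfl

/-- The denominator is positive for `a ∈ [-1, 1]`. [folklore] -/
theorem sliceD_pos (c r : ℝ) {a : ℝ} (ha : a ∈ Icc (-1 : ℝ) 1) : 0 < sliceD c r a := by
  rw [sliceD]
  have hE : 0 < exp (c * r) ^ 2 := by positivity
  rcases lt_or_ge a 1 with h | h
  · nlinarith [ha.1, mul_pos hE (sub_pos.2 h)]
  · have : a = 1 := le_antisymm ha.2 h
    rw [this]; norm_num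

/-- `sliceD_cos_pos` (auxiliary). [folklore] -/
theorem sliceD_cos_pos (c r θ : ℝ) : 0 < sliceD c r (cos θ) := sliceD_pos c r ⟨neg_one_le_cos θ, cos_le_one θ⟩

/-- **Agreement with the angle chart**: for `θ ∈ (-π, π)`,
`sliceY c r (cos θ) (sin θ) = r sin (twistAngle c r θ)` and `sliceX … = r cos (twistAngle c r θ)`. [folklore] -/
theorem sliceY_cos_sin {c r θ : ℝ} (hθ : θ ∈ Ioo (-π) π) : sliceY c r (cos θ) (sin θ) = r * sin (twistAngle c r θ) := by
  rw [sliceY, sliceD, sin_twistAngle hθ]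

/-- `sliceX_cos_sin` (auxiliary). [folklore] -/
theorem sliceX_cos_sin {c r θ : ℝ} (hθ : θ ∈ Ioo (-π) π) : sliceX c r (cos θ) (sin θ) = r * cos (twistAngle c r θ) := by
  rw [sliceX, sliceD, cos_twistAngle hθ]

/-- Agreement for the shifted representative: for `θ ∈ (π, 3π)`,
`sliceY c r (cos θ) (sin θ) = r sin (twistAngle c r (θ - 2π))`. [folklore] -/
theorem sliceY_cos_sin_sub {c r θ : ℝ} (hθ : θ ∈ Ioo π (3 * π)) :
    sliceY c r (cos θ) (sin θ) = r * sin (twistAngle c r (θ - 2 * π)) := by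
  have h : θ - 2 * π ∈ Ioo (-π) π := ⟨by linarith [hθ.1], by linarith [hθ.2]⟩
  rw [← sliceY_cos_sin h, cos_sub_two_pi, sin_sub_two_pi]

/-- `sliceX_cos_sin_sub` (auxiliary). [folklore] -/
theorem sliceX_cos_sin_sub {c r θ : ℝ} (hθ : θ ∈ Ioo π (3 * π)) :
    sliceX c r (cos θ) (sin θ) = r * cos (twistAngle c r (θ - 2 * π)) := by
  have h : θ - 2 * π ∈ Ioo (-π) π := ⟨by linarith [hθ.1], by linarith [hθ.2]⟩
  rw [← sliceX_cos_sin h, cos_sub_two_pi, sin_sub_two_pi]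

/-- At the far point the Cartesian point is `(-r, 0)`. [folklore] -/
theorem sliceY_far (c r : ℝ) : sliceY c r (cos π) (sin π) = 0 := by simp [sliceY, sin_pi]

/-- `sliceX_far` (auxiliary). [folklore] -/
theorem sliceX_far (c r : ℝ) : sliceX c r (cos π) (sin π) = -r := by
  rw [sliceX, sliceD, cos_pi]
  have hE : exp (c * r) ^ 2 ≠ 0 := by positivity
  field_simp
  ring

/-- **The height along the circle of radius `r` is smooth in the angle, everywhere.** [folklore] -/
theorem contDiff_sliceY_circle (c r : ℝ) : ContDiff ℝ ∞ fun θ ↦ sliceY c r (cos θ) (sin θ) := by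
  unfold sliceY sliceD
  refine contDiff_const.mul ((contDiff_const.mul contDiff_sin).div ?_ (fun θ ↦ (sliceD_cos_pos c r θ).ne'))
  exact (contDiff_const.add contDiff_cos).add (contDiff_const.mul (contDiff_const.sub contDiff_cos))

/-- **The derivative of the height along the circle at the far point** is `-r e^{-cr}`. [folklore] -/
theorem hasDerivAt_sliceY_circle_far (c r : ℝ) :
    HasDerivAt (fun θ ↦ sliceY c r (cos θ) (sin θ)) (-(r * exp (-(c * r)))) π := by
  -- write `Y = r · 2E · (sin θ / D θ)` and differentiate the quotient at `π`
  have hD : HasDerivAt (fun θ ↦ sliceD c r (cos θ)) (-sin π + exp (c * r) ^ 2 * (0 - -sin π)) π := by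
    unfold sliceD
    exact ((hasDerivAt_cos π).const_add 1).add (((hasDerivAt_const π (1:ℝ)).sub (hasDerivAt_cos π)).const_mul _)
  simp only [sin_pi, neg_zero, sub_zero, mul_zero, add_zero] at hD
  have hDπ : sliceD c r (cos π) = 2 * exp (c * r) ^ 2 := by rw [sliceD, cos_pi]; ring
  have hq : HasDerivAt (fun θ ↦ sin θ / sliceD c r (cos θ)) ((cos π * sliceD c r (cos π) - sin π * 0) / sliceD c r (cos π) ^ 2) π :=
    (hasDerivAt_sin π).div hD (sliceD_cos_pos c r π).ne'
  rw [sin_pi, cos_pi] at hq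
  rw [cos_pi] at hDπ
  rw [hDπ] at hq
  have h := (hq.const_mul (2 * exp (c * r))).const_mul r
  have e : (fun θ ↦ sliceY c r (cos θ) (sin θ)) = fun θ ↦ r * (2 * exp (c * r) * (sin θ / sliceD c r (cos θ))) := by
    funext θ; rw [sliceY]; ring
  rw [e]
  refine h.congr_deriv ?_
  have hE : exp (c * r) ≠ 0 := (exp_pos _).ne'
  rw [exp_neg]
  field_simp
  ring

/-- The height along the circle is strictly decreasing near the far point: its derivative there is
negative for `r > 0`. [folklore] -/
theorem deriv_sliceY_circle_far_neg (c : ℝ) {r : ℝ} (hr : 0 < r) :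
    deriv (fun θ ↦ sliceY c r (cos θ) (sin θ)) π < 0 := by
  rw [(hasDerivAt_sliceY_circle_far c r).deriv]
  have := exp_pos (-(c * r)); nlinarith

end Literature.Topology.FourManifolds
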